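import Summits.QuantumFields.YangMills.Theorems.IR.AfPincerUcTypChainDeepReduced
import Summits.QuantumFields.YangMills.Theorems.IR.Negative.ClauseIITypChainFalseOfGroundStateChains
import HarnessLib

/-!
# Crux `IR` (stmt-QuantumFields-19354), line `af-pincer-Uc-sharp`: the Laplace engine CUTS BOTH WAYS — zero-temperature SCREENING of the
# core gives the fixed-region slice of `KernelPlaqSparseDeep` for EVERY base, eventually in `β` (seat ym-19354-afpincer-s1 g4)

Helper module for item `stmt-QuantumFields-19354` (`--supports … --as helper`; closes nothing; registry and slot of record «sharp merge
I♯_SC» `Cruxes/IR/Lines/af_pincer_Uc_sharp.lean` sha16 `28967a1bf60ad397` UNTOUCHED; open stub `stub_onsetSharpSC`).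

WHY.  The (ii)-side content of the lane-A supplier targets is kernel plaquette-set sparseness (`KernelPlaqSparse`, p544202; for the deep
re-cut `KernelPlaqSparseDeep`, p557005): `γ_{F'}(ζ){all of X θ-bad} ≤ q^{#X}` for the DLR kernels, UNIFORMLY over exteriors `ζ`, regions
`F ⊆ F'` and meshes `b ≤ B e^{Cβ}`, at base `q = e^{−κβ}`.  Refuter disprove-1 GEN 11 built a kernel Laplace engine
(`GroundStateForcing.kernel_measure_le_of_groundStates`, p557336) and used it NEGATIVELY: ground states that FORCE a plaquette kill
sparseness at a fixed frame.  THIS FILE records that the same engine gives the POSITIVE fixed-frame statement from the OPPOSITE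
zero-temperature hypothesis, so that the content of deep (ii) splits by name into three parts:
* (Z) ZERO-TEMPERATURE SCREENING `GroundStatesScreened ρ θ m Λ Pl ζ`: every ground state of the interior energy of the region `Λ` at
  exterior `ζ` has ALL plaquettes of `Pl` at action `< θ − m` (for the deep class: `Λ = regionEdges w F'`, `Pl = ⋃_{c ∈ F'} deepPlaqs w D c`;
  finite-dimensional, non-convex; what both cooling probes of record MEASURE for `D = 2` on every tested exterior family — depth `≥ 2`
  at `≤ 0.03` of the exterior level — and certify for none);
* (R) the RATE: the engine gives `≤ s` for every `s > 0` from some `β₀(s)` on (compactness, no rate), not `e^{−κβ}`;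
* (U) UNIFORMITY of `β₀` over the resampled regions `F'` (all finite cell sets) and over the frames of mesh `b ≤ B e^{Cβ}` — the thermal ∕
  entropy part (the LEAD's and S1 g2's «research-grade» caveat lives here and in (R)).
(Z) alone ⇒ the `(w, F')`-SLICE of `KernelPlaqSparseDeep` for EVERY base `q ∈ (0, 1]`, eventually in `β` (this file); (Z)+(R)+(U) would be
the conjunct itself.  Dually (file `Negative/ClauseIITypChainDeepFalseOfDeepGroundStateChains`, this seat): ONE deep-guard-clean exterior
whose ground states force ONE deep plaquette above `θ + m` ⇒ `¬ KernelPlaqSparseDeep` at that frame for every base `< 1`, eventually.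
So at a fixed frame the deep conjunct (ii) is decided — up to the margin `m` and exteriors with DEGENERATE ground states (some screened,
some not) — by a zero-temperature variational question on the compact fibre `G^{Λ}`.

CONTENTS (namespace `…SharpLanes.GroundStateScreening`):
* §1 `KernelPlaqSparseDeepOn … F'` — the `F'`-slice of `KernelPlaqSparseDeep` (`kernelPlaqSparseDeep_iff_forall_on`).
* §2 `GroundStatesScreened`; `kernel_exists_bad_le_of_groundStatesScreened` (closed exterior family `K` ⇒ `γ_Λ^β(ζ){some p ∈ Pl θ-bad}
  ≤ s` on an open `O ⊇ K` for `β ≥ β₀`; majorant `Σ_{p ∈ Pl} softBad_{θ−m,m}(p, ·)`), the one-exterior form `_at`, and the all-exteriors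
  form for plaquette SETS (`kernel_forall_bad_le_of_groundStatesScreened_univ`).
* §3 `kernelPlaqSparseDeepOn_of_groundStatesScreened`: (Z) for the deep plaquettes of `F'` under ALL exteriors ⇒ `∀ q ∈ (0, 1] ∃ β₀ ∀ β ≥ β₀,
  KernelPlaqSparseDeepOn ρ β w θ ℓ₀ D q F'` (base bookkeeping: `s = q^{#⋃ deepPlaqs}`, `q ≤ 1`); the guard is not even used.
* §4 `ClauseIIukpOn … F'` (the `F'`-slice of clause (ii), `clauseIIukp_iff_forall_on`), the sliced reduction
  `clauseIIukpOn_typChainDeep_of_kernelPlaqSparseDeepOn` (S1 g2's per-measure Peierls bound), and the headline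
  **`clauseIIukpOn_typChainDeep_of_groundStatesScreened`**: (Z) for the core of `F'` under all exteriors ⇒ `∀ δ > 0 ∃ β₀ ∀ β ≥ β₀`, the
  `F'`-slice of clause (ii) for `TypChainDeep ρ θ w ℓ₀ D` on the mesh-`b` frame `w` — the exact positive dual of disprove-1's fixed-frame kill.

HONEST FRAMING: fixed frame, fixed region, no rate; (Z) is a HYPOTHESIS asserted for no datum; nothing here proves `KernelPlaqSparseDeep`,
clause (ii), `TypChainDeepReducedAtSC`, `OnsetSharpUKPcSC` or `IR`; nothing of weak-coupling mixing, asymptotic freedom or a mass gap; not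
infinite volume, not Clay.  No `sorry`; axioms ⊆ {propext, Classical.choice, Quot.sound}; no instances, no notation.
-/

set_option autoImplicit false

noncomputable section

open MeasureTheory Filter Topology
open Literature.MathematicalPhysics.QuantumFieldTheory hiding ZdEdge
open Literature.MathematicalPhysics.QuantumLattice
open Literature.Probability.LatticeModels
open Summit.QuantumFields.YangMills.Cruxes.IR.Tempered (regionEdges)
open Summit.QuantumFields.YangMills.Theorems.OddTorusChessboard (plaqAction measurable_plaqAction)

namespace Summit.QuantumFields.YangMills.Cruxes.IR.AfPincerUc.SharpLanes.GroundStateScreening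

open Summit.QuantumFields.YangMills.Cruxes.IR.AfPincerUc
open Summit.QuantumFields.YangMills.Cruxes.IR.AfPincerUc.SharpLanes
open Summit.QuantumFields.YangMills.Cruxes.IR.AfPincerUc.SharpLanes.GroundStateForcing

/-! ## §1 The fixed-region slice of deep kernel sparseness -/
section Slice

variable {G : Type} [Group G] [TopologicalSpace G] [IsTopologicalGroup G] [CompactSpace G]
  [MeasurableSpace G] [BorelSpace G]

/-- **The `F'`-slice of `KernelPlaqSparseDeep`**: the body of `KernelPlaqSparseDeep ρ β w θ ℓ₀ D q` (p557005) with the resampled region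
`F'` FIXED — for all nonempty `F ⊆ F'`, every exterior meeting the deep guard, every `X ⊆ ⋃_{c ∈ F} deepPlaqs w D c`:
`γ_{F'}(ζ){σ | ∀ p ∈ X, θ ≤ plaqAction ρ p σ} ≤ q ^ #X`.  `KernelPlaqSparseDeep` is the conjunction over `F'` (`kernelPlaqSparseDeep_iff_forall_on`). -/
def KernelPlaqSparseDeepOn {N : ℕ} (ρ : G →* Matrix (Fin N) (Fin N) ℂ) (β : ℝ) (w : Fin 4 → ℤ → ℤ) (θ : ℝ) (ℓ₀ D : ℕ) (q : ℝ)
    (F' : Finset (Fin 4 → ℤ)) : Prop :=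
  ∀ F : Finset (Fin 4 → ℤ), F ⊆ F' → F.Nonempty → ∀ ζ : LGConfig 4 G,
    (∀ c ∈ F, ∀ c' : Fin 4 → ℤ, (∀ i, |c' i - c i| ≤ 1) → c' ∈ F' ∨ ζ ∈ TypChainDeep ρ θ w ℓ₀ D c') →
      ∀ X : Finset (ZdPlaquette 4), X ⊆ F.biUnion (deepPlaqs w D) →
        (ymSpecification ρ β (regionEdges w F') ζ) {σ : LGConfig 4 G | ∀ p ∈ X, θ ≤ plaqAction ρ p σ} ≤
          ENNReal.ofReal (q ^ X.card)

/-- `KernelPlaqSparseDeep` IS the conjunction of its `F'`-slices. -/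
theorem kernelPlaqSparseDeep_iff_forall_on {N : ℕ} (ρ : G →* Matrix (Fin N) (Fin N) ℂ) (β : ℝ) (w : Fin 4 → ℤ → ℤ) (θ : ℝ)
    (ℓ₀ D : ℕ) (q : ℝ) :
    KernelPlaqSparseDeep ρ β w θ ℓ₀ D q ↔ ∀ F' : Finset (Fin 4 → ℤ), KernelPlaqSparseDeepOn ρ β w θ ℓ₀ D q F' :=
  ⟨fun h F' F hFF' => h F F' hFF', fun h F F' hFF' => h F' F hFF'⟩

end Slice

/-! ## §2 Zero-temperature SCREENING and what the Laplace engine makes of it -/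
section Screening

variable {G : Type} [Group G] [TopologicalSpace G] [IsTopologicalGroup G] [CompactSpace G]
  [MeasurableSpace G] [BorelSpace G] [SecondCountableTopology G] {N : ℕ} (ρ : G →* Matrix (Fin N) (Fin N) ℂ)

/-- **HYPOTHESIS (Z) «ground states SCREEN the family `Pl`» (zero temperature, finite-dimensional; asserted for no datum).**  At exterior
`ζ`, EVERY ground state `x` of the interior energy of the link set `Λ` (`GroundStateForcing.IsGroundState`, all other links frozen to `ζ`)
has every plaquette of `Pl` at action `< θ − m` in the glued configuration.  For the deep class: `Λ = regionEdges w F'`,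
`Pl = ⋃_{c ∈ F'} deepPlaqs w D c` — what both cooling probes of record measure at `D = 2` (depth `≥ 2` carries `≤ 0.03` of the exterior
level on every tested family: FORCING-NUMERICS-g3 rev 2, FINDING-flux-adversary #56, TYPCHAINDEEP-S1-g3 rev 3).  The opposite hypothesis
at ONE plaquette is `GroundStateForcing.GroundStatesForce`. -/
def GroundStatesScreened (θ m : ℝ) (Λ : Finset (ZdEdge 4)) (Pl : Finset (ZdPlaquette 4)) (ζ : LGConfig 4 G) : Prop :=
  ∀ x : ↥Λ → G, IsGroundState ρ Λ ζ x → ∀ p ∈ Pl, plaqAction ρ p (glueWith Λ x ζ) < θ - m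

omit [TopologicalSpace G] [IsTopologicalGroup G] [CompactSpace G] [MeasurableSpace G] [BorelSpace G] [SecondCountableTopology G] in
/-- Screening is hereditary in the plaquette family. -/
theorem GroundStatesScreened.mono {θ m : ℝ} {Λ : Finset (ZdEdge 4)} {Pl Pl' : Finset (ZdPlaquette 4)} (hPl : Pl ⊆ Pl')
    {ζ : LGConfig 4 G} (h : GroundStatesScreened ρ θ m Λ Pl' ζ) : GroundStatesScreened ρ θ m Λ Pl ζ :=
  fun x hx p hp => h x hx p (hPl hp)

omit [TopologicalSpace G] [IsTopologicalGroup G] [CompactSpace G] [MeasurableSpace G] [BorelSpace G] [SecondCountableTopology G] in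
/-- Screening (margin `m`, family `Pl`) and forcing (margin `m'`, a plaquette `p ∈ Pl`) EXCLUDE each other at an exterior whose interior
energy has a ground state (nonnegative margins). -/
theorem not_groundStatesForce_of_screened {θ m m' : ℝ} (hm : 0 ≤ m) (hm' : 0 ≤ m') {w : Fin 4 → ℤ → ℤ} {c : Fin 4 → ℤ}
    {Pl : Finset (ZdPlaquette 4)} {p : ZdPlaquette 4} (hp : p ∈ Pl) {ζ : LGConfig 4 G}
    (hex : ∃ x : ↥(regionEdges w {c}) → G, IsGroundState ρ (regionEdges w {c}) ζ x)
    (h : GroundStatesScreened ρ θ m (regionEdges w {c}) Pl ζ) : ¬ GroundStatesForce ρ θ m' w c p ζ := by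
  intro hF
  obtain ⟨x, hx⟩ := hex
  have h1 := h x hx p hp
  have h2 := hF x hx
  linarith

omit [CompactSpace G] in
/-- The event «some plaquette of `Pl` is `θ`-bad» is measurable (continuous `ρ`). -/
theorem measurableSet_exists_bad (hρ : Continuous ρ) (θ : ℝ) (Pl : Finset (ZdPlaquette 4)) :
    MeasurableSet {σ : LGConfig 4 G | ∃ p ∈ Pl, θ ≤ plaqAction ρ p σ} := by
  have hrepr : {σ : LGConfig 4 G | ∃ p ∈ Pl, θ ≤ plaqAction ρ p σ} = ⋃ p ∈ Pl, {σ | θ ≤ plaqAction ρ p σ} := by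
    ext σ; simp
  rw [hrepr]
  exact Finset.measurableSet_biUnion _ fun p _ => measurableSet_le measurable_const (measurable_plaqAction ρ hρ p)

/-- **(Z) on a closed family of exteriors ⇒ the kernel rarely sees a `θ`-bad plaquette of `Pl` (PROVED; fixed `Λ`, no rate).**  If the
ground states screen `Pl` (margin `m > 0`) at every exterior of the closed family `K`, then for every `s > 0` there are an OPEN `O ⊇ K` and
`β₀` with `γ_Λ^β(ζ){σ | ∃ p ∈ Pl, θ ≤ plaqAction ρ p σ} ≤ s` for all `β ≥ β₀`, `ζ ∈ O`.  Engine: `GroundStateForcing.kernel_measure_le_of_groundStates`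
with the continuous majorant `Σ_{p ∈ Pl} softBad_{θ−m, m}(p, ·)` (`≥ 1` on the event, `= 0` at screened ground states). -/
theorem kernel_exists_bad_le_of_groundStatesScreened (hρ : Continuous ρ) {θ m : ℝ} (hm : 0 < m) (Λ : Finset (ZdEdge 4))
    (Pl : Finset (ZdPlaquette 4)) {K : Set (LGConfig 4 G)} (hK : IsClosed K)
    (hGS : ∀ ζ ∈ K, GroundStatesScreened ρ θ m Λ Pl ζ) {s : ℝ} (hs : 0 < s) :
    ∃ O : Set (LGConfig 4 G), IsOpen O ∧ K ⊆ O ∧ ∃ β₀ : ℝ, ∀ β : ℝ, β₀ ≤ β → ∀ ζ ∈ O,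
      (ymSpecification ρ β Λ ζ) {σ : LGConfig 4 G | ∃ p ∈ Pl, θ ≤ plaqAction ρ p σ} ≤ ENNReal.ofReal s := by
  have hθ : θ - m + m = θ := sub_add_cancel θ m
  refine kernel_measure_le_of_groundStates ρ hρ Λ hK (measurableSet_exists_bad ρ hρ θ Pl)
    (g := fun σ => ∑ p ∈ Pl, softBad ρ (θ - m) m p σ)
    (continuous_finsetSum _ fun p _ => continuous_softBad ρ hρ (θ - m) m p) ?_
    (fun σ => Finset.sum_nonneg fun p _ => softBad_nonneg ρ (θ - m) m p σ) ?_ hs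
  · rintro σ ⟨p, hp, hbad⟩
    have h1 : softBad ρ (θ - m) m p σ = 1 := softBad_eq_one_of_le ρ hm (by rw [hθ]; exact hbad)
    calc (1 : ℝ) = softBad ρ (θ - m) m p σ := h1.symm
      _ ≤ ∑ p' ∈ Pl, softBad ρ (θ - m) m p' σ :=
          Finset.single_le_sum (fun p' _ => softBad_nonneg ρ (θ - m) m p' σ) hp
  · intro ζ hζ x hx
    exact (Finset.sum_eq_zero fun p hp => softBad_eq_zero_of_lt ρ hm (hGS ζ hζ x hx p hp)).le

/-- **(Z) at ONE exterior ⇒ the same bound on an open neighbourhood of it (PROVED; no separation hypothesis on `G`)** — via the closed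
family `closure {ζ}`, thermodynamically identical to `ζ` (`GroundStateForcing.eq_of_mem_closure_singleton`). -/
theorem kernel_exists_bad_le_of_groundStatesScreened_at (hρ : Continuous ρ) {θ m : ℝ} (hm : 0 < m) (Λ : Finset (ZdEdge 4))
    (Pl : Finset (ZdPlaquette 4)) {ζ : LGConfig 4 G} (hGS : GroundStatesScreened ρ θ m Λ Pl ζ) {s : ℝ} (hs : 0 < s) :
    ∃ O : Set (LGConfig 4 G), IsOpen O ∧ ζ ∈ O ∧ ∃ β₀ : ℝ, ∀ β : ℝ, β₀ ≤ β → ∀ ζ' ∈ O,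
      (ymSpecification ρ β Λ ζ') {σ : LGConfig 4 G | ∃ p ∈ Pl, θ ≤ plaqAction ρ p σ} ≤ ENNReal.ofReal s := by
  have hK : ∀ y ∈ closure ({ζ} : Set (LGConfig 4 G)), GroundStatesScreened ρ θ m Λ Pl y := by
    intro y hy x hx p hp
    have hc : Continuous (plaqAction (G := G) ρ p) := continuous_const.sub (continuous_plaquetteObs ρ hρ p.1 p.2.1.1 p.2.1.2)
    rw [eq_of_mem_closure_singleton hy Λ hc x]
    exact hGS x ((isGroundState_iff_of_mem_closure_singleton ρ hρ hy Λ x).1 hx) p hp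
  obtain ⟨O, hO, hKO, β₀, h⟩ := kernel_exists_bad_le_of_groundStatesScreened ρ hρ hm Λ Pl isClosed_closure hK hs
  exact ⟨O, hO, hKO (subset_closure (Set.mem_singleton ζ)), β₀, h⟩

/-- **(Z) under ALL exteriors ⇒ every nonempty SET of plaquettes of `Pl` is all-`θ`-bad with kernel probability `≤ s`, uniformly in the
exterior, for `β ≥ β₀(s)` (PROVED; fixed `Λ`, no rate)** — `K = univ` (the exterior space is compact) and monotonicity of the event. -/
theorem kernel_forall_bad_le_of_groundStatesScreened_univ (hρ : Continuous ρ) {θ m : ℝ} (hm : 0 < m) (Λ : Finset (ZdEdge 4))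
    (Pl : Finset (ZdPlaquette 4)) (hGS : ∀ ζ : LGConfig 4 G, GroundStatesScreened ρ θ m Λ Pl ζ) {s : ℝ} (hs : 0 < s) :
    ∃ β₀ : ℝ, ∀ β : ℝ, β₀ ≤ β → ∀ ζ : LGConfig 4 G, ∀ X : Finset (ZdPlaquette 4), X ⊆ Pl → X.Nonempty →
      (ymSpecification ρ β Λ ζ) {σ : LGConfig 4 G | ∀ p ∈ X, θ ≤ plaqAction ρ p σ} ≤ ENNReal.ofReal s := by
  obtain ⟨O, -, hKO, β₀, h⟩ :=
    kernel_exists_bad_le_of_groundStatesScreened ρ hρ hm Λ Pl isClosed_univ (fun ζ _ => hGS ζ) hs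
  refine ⟨β₀, fun β hβ ζ X hX hXne => (measure_mono ?_).trans (h β hβ ζ (hKO (Set.mem_univ ζ)))⟩
  intro σ hσ
  obtain ⟨p, hp⟩ := hXne
  exact ⟨p, hX hp, hσ p hp⟩

end Screening

/-! ## §3 (Z) for the core of a fixed region ⇒ the slice of `KernelPlaqSparseDeep`, every base, eventually -/
section DeepSlice

variable {G : Type} [Group G] [TopologicalSpace G] [IsTopologicalGroup G] [CompactSpace G]
  [MeasurableSpace G] [BorelSpace G] [SecondCountableTopology G] {N : ℕ} (ρ : G →* Matrix (Fin N) (Fin N) ℂ)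

/-- **Zero-temperature screening of the core ⇒ the `(w, F')`-slice of deep kernel sparseness for EVERY base `q ∈ (0, 1]`, eventually in
`β` (PROVED; fixed frame, fixed region, no rate, guard unused).**  If under EVERY exterior every ground state of the interior energy of
`regionEdges w F'` has all DEEP plaquettes `⋃_{c ∈ F'} deepPlaqs w D c` at action `< θ − m` (`m > 0`), then for every `0 < q ≤ 1` there is
`β₀` with `KernelPlaqSparseDeepOn ρ β w θ ℓ₀ D q F'` for all `β ≥ β₀` (take `s = q^{#⋃ deepPlaqs}` in
`kernel_forall_bad_le_of_groundStatesScreened_univ`; `q^{N} ≤ q^{#X}` for `X` inside, `X = ∅` by total mass `1`).  What separates this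
from `KernelPlaqSparseDeep` at base `e^{−κβ}`: the RATE (R) and the UNIFORMITY (U) of `β₀` over `F'` and over meshes `b ≤ B e^{Cβ}`. -/
theorem kernelPlaqSparseDeepOn_of_groundStatesScreened (hρ : Continuous ρ) {θ m : ℝ} (hm : 0 < m) (w : Fin 4 → ℤ → ℤ)
    (ℓ₀ D : ℕ) (F' : Finset (Fin 4 → ℤ))
    (hGS : ∀ ζ : LGConfig 4 G, GroundStatesScreened ρ θ m (regionEdges w F') (F'.biUnion (deepPlaqs w D)) ζ)
    {q : ℝ} (hq0 : 0 < q) (hq1 : q ≤ 1) :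
    ∃ β₀ : ℝ, ∀ β : ℝ, β₀ ≤ β → KernelPlaqSparseDeepOn ρ β w θ ℓ₀ D q F' := by
  obtain ⟨β₀, h⟩ := kernel_forall_bad_le_of_groundStatesScreened_univ ρ hρ hm (regionEdges w F')
    (F'.biUnion (deepPlaqs w D)) hGS (pow_pos hq0 (F'.biUnion (deepPlaqs w D)).card)
  refine ⟨β₀, fun β hβ F hFF' _ ζ _ X hX => ?_⟩
  haveI := isProbabilityMeasure_ymSpecification ρ hρ β (regionEdges w F') ζ
  have hXsub : X ⊆ F'.biUnion (deepPlaqs w D) := hX.trans (Finset.biUnion_subset_biUnion_of_subset_left _ hFF')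
  rcases X.eq_empty_or_nonempty with rfl | hXne
  · rw [Finset.card_empty, pow_zero, ENNReal.ofReal_one]
    exact prob_le_one
  · exact (h β hβ ζ X hXsub hXne).trans
      (ENNReal.ofReal_le_ofReal (pow_le_pow_of_le_one hq0.le hq1 (Finset.card_le_card hXsub)))

/-- **Single cell (`F' = {c}`), the instance the cooling probes address:** screening of `deepPlaqs w D c` under all exteriors of the cell
⇒ the `{c}`-slice of `KernelPlaqSparseDeep` for every base `q ∈ (0, 1]`, eventually in `β`. -/
theorem kernelPlaqSparseDeepOn_singleton_of_groundStatesScreened (hρ : Continuous ρ) {θ m : ℝ} (hm : 0 < m)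
    (w : Fin 4 → ℤ → ℤ) (ℓ₀ D : ℕ) (c : Fin 4 → ℤ)
    (hGS : ∀ ζ : LGConfig 4 G, GroundStatesScreened ρ θ m (regionEdges w {c}) (deepPlaqs w D c) ζ)
    {q : ℝ} (hq0 : 0 < q) (hq1 : q ≤ 1) :
    ∃ β₀ : ℝ, ∀ β : ℝ, β₀ ≤ β → KernelPlaqSparseDeepOn ρ β w θ ℓ₀ D q {c} :=
  kernelPlaqSparseDeepOn_of_groundStatesScreened ρ hρ hm w ℓ₀ D {c} (by rwa [Finset.singleton_biUnion]) hq0 hq1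

end DeepSlice

/-! ## §4 … and the slice of clause (ii) for the deep class, EVERY budget, eventually -/
section ClauseSlice

variable {G : Type} [Group G] [TopologicalSpace G] [IsTopologicalGroup G] [CompactSpace G]
  [MeasurableSpace G] [BorelSpace G]

/-- **The `F'`-slice of clause (ii) in UKP form**: the body of `ClauseIIukp ρ β w δ Typ` (`AfPincerUcFormat`) with the resampled region `F'`
FIXED.  `ClauseIIukp` is the conjunction over `F'` (`clauseIIukp_iff_forall_on`). -/
def ClauseIIukpOn {N : ℕ} (ρ : G →* Matrix (Fin N) (Fin N) ℂ) (β : ℝ) (w : Fin 4 → ℤ → ℤ) (δ : ℝ)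
    (Typ : (Fin 4 → ℤ) → Set (LGConfig 4 G)) (F' : Finset (Fin 4 → ℤ)) : Prop :=
  ∀ F : Finset (Fin 4 → ℤ), F ⊆ F' → F.Nonempty → ∀ ζ : LGConfig 4 G,
    (∀ c ∈ F, ∀ c' : Fin 4 → ℤ, (∀ i, |c' i - c i| ≤ 1) → c' ∈ F' ∨ ζ ∈ Typ c') →
      (ymSpecification ρ β (regionEdges w F') ζ) {σ : LGConfig 4 G | ∀ c ∈ F, σ ∉ Typ c} ≤ ENNReal.ofReal (δ ^ F.card)

/-- `ClauseIIukp` IS the conjunction of its `F'`-slices. -/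
theorem clauseIIukp_iff_forall_on {N : ℕ} (ρ : G →* Matrix (Fin N) (Fin N) ℂ) (β : ℝ) (w : Fin 4 → ℤ → ℤ) (δ : ℝ)
    (Typ : (Fin 4 → ℤ) → Set (LGConfig 4 G)) :
    ClauseIIukp ρ β w δ Typ ↔ ∀ F' : Finset (Fin 4 → ℤ), ClauseIIukpOn ρ β w δ Typ F' :=
  ⟨fun h F' F hFF' => h F F' hFF', fun h F F' hFF' => h F' F hFF'⟩

variable {N : ℕ} (ρ : G →* Matrix (Fin N) (Fin N) ℂ)

/-- **Sliced reduction (PROVED):** the `F'`-slice of deep kernel sparseness gives the `F'`-slice of clause (ii) for `TypChainDeep` with the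
budget of record (`3750 q ≤ 1/2`, `192 b⁴ q (3750 q)^{⌈ℓ₀/2⌉} ≤ δ`) — S1 g3's `clauseIIukp_typChainDeep_of_kernelPlaqSparseDeep` per region,
S1 g2's hereditary Peierls bound `measure_forall_hasBadChainAmong_le_pow` being per measure. -/
theorem clauseIIukpOn_typChainDeep_of_kernelPlaqSparseDeepOn (β : ℝ) {b : ℕ} {w : Fin 4 → ℤ → ℤ} (hw : IsFrame b w) {θ : ℝ}
    {ℓ₀ D : ℕ} {q δ : ℝ} (hq0 : 0 ≤ q) (hq : 3750 * q ≤ 1 / 2)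
    (hδ : 192 * (b : ℝ) ^ 4 * q * (3750 * q) ^ ((ℓ₀ + 1) / 2) ≤ δ) {F' : Finset (Fin 4 → ℤ)}
    (hK : KernelPlaqSparseDeepOn ρ β w θ ℓ₀ D q F') : ClauseIIukpOn ρ β w δ (TypChainDeep ρ θ w ℓ₀ D) F' := by
  classical
  intro F hFF' hF ζ hguard
  have hn : ∀ c ∈ F, (deepPlaqs w D c).card ≤ 96 * b ^ 4 := fun c _ => card_deepPlaqs_le hw D c
  have hmain := measure_forall_hasBadChainAmong_le_pow ρ (ymSpecification ρ β (regionEdges w F') ζ) id θ F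
    (deepPlaqs w D) (F.biUnion (deepPlaqs w D)) (fun c hc => Finset.subset_biUnion_of_mem _ hc)
    (fun c _ c' _ hcc => disjoint_deepPlaqs hw D hcc) hn hq0 hq (fun X hX => hK F hFF' hF ζ hguard X hX) ℓ₀
  have hev : {σ : LGConfig 4 G | ∀ c ∈ F, σ ∉ TypChainDeep ρ θ w ℓ₀ D c} =
      {σ | ∀ c ∈ F, HasBadChainAmong ρ θ (↑(deepPlaqs w D c)) ℓ₀ (id σ)} := by
    ext σ
    simp only [Set.mem_setOf_eq, TypChainDeep, not_not, id]
  rw [hev]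
  refine hmain.trans (ENNReal.ofReal_le_ofReal (pow_le_pow_left₀ (by positivity) ?_ _))
  calc 2 * ((96 * b ^ 4 : ℕ) : ℝ) * q * (3750 * q) ^ ((ℓ₀ + 1) / 2)
      = 192 * (b : ℝ) ^ 4 * q * (3750 * q) ^ ((ℓ₀ + 1) / 2) := by push_cast; ring
    _ ≤ δ := hδ

/-- **(Z) for the core of a fixed region ⇒ the `F'`-slice of clause (ii) for `TypChainDeep` with EVERY budget `δ > 0`, eventually in `β`
(PROVED; fixed mesh-`b` frame, fixed region, no rate).**  The exact positive dual of part 1/2's fixed-frame kill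
`not_clauseIIukp_typChain[Deep]_of_groundStatesChained[Deep]`: there ONE exterior with CHAINED ground states denies the `{c}`-slice for
every `δ < 1`; here SCREENED ground states under all exteriors grant the `F'`-slice for every `δ > 0` (base `q = min(1/7500, δ/(192 b⁴ + 1))`). -/
theorem clauseIIukpOn_typChainDeep_of_groundStatesScreened [SecondCountableTopology G] (hρ : Continuous ρ) {θ m : ℝ}
    (hm : 0 < m) {b : ℕ} {w : Fin 4 → ℤ → ℤ} (hw : IsFrame b w) (ℓ₀ D : ℕ) (F' : Finset (Fin 4 → ℤ))
    (hGS : ∀ ζ : LGConfig 4 G, GroundStatesScreened ρ θ m (regionEdges w F') (F'.biUnion (deepPlaqs w D)) ζ)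
    {δ : ℝ} (hδ : 0 < δ) :
    ∃ β₀ : ℝ, ∀ β : ℝ, β₀ ≤ β → ClauseIIukpOn ρ β w δ (TypChainDeep ρ θ w ℓ₀ D) F' := by
  have hpos : 0 < 192 * (b : ℝ) ^ 4 + 1 := by positivity
  set q : ℝ := min (1 / 7500) (δ / (192 * (b : ℝ) ^ 4 + 1)) with hqdef
  have hq0 : 0 < q := lt_min (by norm_num) (div_pos hδ hpos)
  have hqa : q ≤ 1 / 7500 := min_le_left _ _
  have hqb : q ≤ δ / (192 * (b : ℝ) ^ 4 + 1) := min_le_right _ _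
  have hq1 : q ≤ 1 := hqa.trans (by norm_num)
  have hq : 3750 * q ≤ 1 / 2 := by linarith
  have hbud : 192 * (b : ℝ) ^ 4 * q * (3750 * q) ^ ((ℓ₀ + 1) / 2) ≤ δ := by
    have hK : (3750 * q) ^ ((ℓ₀ + 1) / 2) ≤ 1 := pow_le_one₀ (by positivity) (by linarith)
    have h1 : (192 * (b : ℝ) ^ 4 + 1) * q ≤ δ := by
      calc (192 * (b : ℝ) ^ 4 + 1) * q ≤ (192 * (b : ℝ) ^ 4 + 1) * (δ / (192 * (b : ℝ) ^ 4 + 1)) :=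
            mul_le_mul_of_nonneg_left hqb hpos.le
        _ = δ := by field_simp
    calc 192 * (b : ℝ) ^ 4 * q * (3750 * q) ^ ((ℓ₀ + 1) / 2) ≤ 192 * (b : ℝ) ^ 4 * q * 1 :=
          mul_le_mul_of_nonneg_left hK (by positivity)
      _ ≤ δ := by nlinarith [hq0.le]
  obtain ⟨β₀, h⟩ := kernelPlaqSparseDeepOn_of_groundStatesScreened ρ hρ hm w ℓ₀ D F' hGS hq0 hq1
  exact ⟨β₀, fun β hβ => clauseIIukpOn_typChainDeep_of_kernelPlaqSparseDeepOn ρ β hw hq0.le hq hbud (h β hβ)⟩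

end ClauseSlice

end Summit.QuantumFields.YangMills.Cruxes.IR.AfPincerUc.SharpLanes.GroundStateScreening

end
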